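import Summits.CriticalPhenomena.PercolationContinuityZ3.Theorems.PercNearOneGluingNoHeavyLowerTailThreePointProductFormFibreSeriesPieceMask
import HarnessLib

/-!
# The series piece, V: the mark pieces (Sahi programme, prover prim-sahi-p2 gen 59)

Support file (`--supports stmt-CriticalPhenomena-4575`, helper); continues `…ThreePointProductFormFibreSeriesPieceMask` (same gen).
Standard axioms, no sorries, no named facts, no definitions.  Memo `run/shared/lean/prim/prim-sahi/FROM-prim-sahi-p2-gen59-ONE-STEP-LEMMA.md` §2, §8(2).

`two_mul_card_markS_*`, `two_mul_card_markC_*` — a MARK piece (a single label `m : a — s`, resp. `a — c`, mask `fun y => decide (y = m)`) is the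
series piece over the EMPTY sub-instance with `u = s` (resp. `u = c`); its six statistics `(S0, isoC, isoS, Ga, Gb, G1)` are
`(U/2)·(1, 2, 1, 1, 0, 0)` resp. `(U/2)·(1, 1, 2, 0, 1, 0)` with `U = 2^{#α}`, stated as `2·N = U + 0` etc. — the mark factors of the tree
recursion (68j): an `s`-mark doubles `#(S0∪P1)` and kills `Gb, G1`.
[this work] (gen 59).
-/

namespace Summit.CriticalPhenomena.PercolationContinuityZ3.Theorems.ProductFormFibre

open Finset Literature.Probability.Percolation
open Summit.CriticalPhenomena.PercolationContinuityZ3.Theorems.ThreePointCPIClusterSwap (clusterFlip)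

variable {V α : Type*}

/-! ### Mark pieces -/

section Marks

variable [Fintype α] [DecidableEq α] [DecidableEq V] (ends : α → Sym2 V) (s a c : V) (m : α)


open Classical in
/-- Mark piece `s`-mark, statistic `S0`: `2·N = U + 0` (in units of configurations). [this work] -/
theorem two_mul_card_markS_S0 (hm : ends m = s(a, s)) (hsa : s ≠ a) (hca : c ≠ a) (hsc : s ≠ c) :
    2 * (univ.filter fun z : α → Bool =>
        ((¬ (openGraph (labelledOpen ends (fun y => z y && decide (y = m)))).Reachable s a ∧
        ¬ (openGraph (labelledOpen ends (fun y => z y && decide (y = m)))).Reachable s c) ∧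
        (¬ (openGraph (labelledOpen ends (fun y => z y && decide (y = m)))).Reachable c a ∧
        ¬ (openGraph (labelledOpen ends (fun y => z y && decide (y = m)))).Reachable c s))).card =
    (univ : Finset (α → Bool)).card + 0 := by
  have h := two_mul_card_series_S0_mask ends s a c s m (fun _ => false) hm hsa hsa hca
    (fun l hl => absurd hl Bool.false_ne_true) rfl
  simp only [Bool.or_false] at h
  rw [h]
  have hR := reachable_and_false ends
  congr 1
  · rw [Finset.filter_true_of_mem (fun z _ => by simp only [hR]; clear h; aesop)]
  · rw [Finset.filter_false_of_mem (fun z _ => by simp only [hR]; clear h; aesop), Finset.card_empty]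


open Classical in
/-- Mark piece `s`-mark, statistic `isoC`: `2·N = U + U` (in units of configurations). [this work] -/
theorem two_mul_card_markS_isoC (hm : ends m = s(a, s)) (hsa : s ≠ a) (hca : c ≠ a) (hsc : s ≠ c) :
    2 * (univ.filter fun z : α → Bool =>
        (¬ (openGraph (labelledOpen ends (fun y => z y && decide (y = m)))).Reachable c a ∧
        ¬ (openGraph (labelledOpen ends (fun y => z y && decide (y = m)))).Reachable c s)).card =
    (univ : Finset (α → Bool)).card + (univ : Finset (α → Bool)).card := by
  have h := two_mul_card_series_isoC_mask ends s a c s m (fun _ => false) hm hsa hsa hca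
    (fun l hl => absurd hl Bool.false_ne_true) rfl
  simp only [Bool.or_false] at h
  rw [h]
  have hR := reachable_and_false ends
  congr 1
  · rw [Finset.filter_true_of_mem (fun z _ => by simp only [hR]; clear h; aesop)]
  · rw [Finset.filter_true_of_mem (fun z _ => by simp only [hR]; clear h; aesop)]


open Classical in
/-- Mark piece `s`-mark, statistic `isoS`: `2·N = U + 0` (in units of configurations). [this work] -/
theorem two_mul_card_markS_isoS (hm : ends m = s(a, s)) (hsa : s ≠ a) (hca : c ≠ a) (hsc : s ≠ c) :
    2 * (univ.filter fun z : α → Bool =>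
        (¬ (openGraph (labelledOpen ends (fun y => z y && decide (y = m)))).Reachable s a ∧
        ¬ (openGraph (labelledOpen ends (fun y => z y && decide (y = m)))).Reachable s c)).card =
    (univ : Finset (α → Bool)).card + 0 := by
  have h := two_mul_card_series_isoS_mask ends s a c s m (fun _ => false) hm hsa hsa hca
    (fun l hl => absurd hl Bool.false_ne_true) rfl
  simp only [Bool.or_false] at h
  rw [h]
  have hR := reachable_and_false ends
  congr 1
  · rw [Finset.filter_true_of_mem (fun z _ => by simp only [hR]; clear h; aesop)]
  · rw [Finset.filter_false_of_mem (fun z _ => by simp only [hR]; clear h; aesop), Finset.card_empty]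


open Classical in
/-- Mark piece `s`-mark, statistic `Ga`: `2·N = U + 0` (in units of configurations). [this work] -/
theorem two_mul_card_markS_Ga (hm : ends m = s(a, s)) (hsa : s ≠ a) (hca : c ≠ a) (hsc : s ≠ c) :
    2 * (univ.filter fun z : α → Bool =>
        (((¬ (openGraph (labelledOpen ends (fun y => z y && decide (y = m)))).Reachable s a ∧
        ¬ (openGraph (labelledOpen ends (fun y => z y && decide (y = m)))).Reachable s c) ∧
        (¬ (openGraph (labelledOpen ends (fun y => z y && decide (y = m)))).Reachable c a ∧
        ¬ (openGraph (labelledOpen ends (fun y => z y && decide (y = m)))).Reachable c s)) ∧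
        (¬ (openGraph (labelledOpen ends (fun l =>
          clusterFlip ends a (fun y => !(z y && decide (y = m))) l && decide (l = m)))).Reachable c a ∧
        ¬ (openGraph (labelledOpen ends (fun l =>
          clusterFlip ends a (fun y => !(z y && decide (y = m))) l && decide (l = m)))).Reachable c s))).card =
    (univ : Finset (α → Bool)).card + 0 := by
  have h := two_mul_card_series_Ga_mask ends s a c s m (fun _ => false) hm hsa hsa hca
    (fun l hl => absurd hl Bool.false_ne_true) rfl
  simp only [Bool.or_false] at h
  rw [h]
  have hR := reachable_and_false ends
  congr 1
  · rw [Finset.filter_true_of_mem (fun z _ => by simp only [hR]; clear h; aesop)]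
  · rw [Finset.filter_false_of_mem (fun z _ => by simp only [hR]; clear h; aesop), Finset.card_empty]


open Classical in
/-- Mark piece `s`-mark, statistic `Gb`: `2·N = 0 + 0` (in units of configurations). [this work] -/
theorem two_mul_card_markS_Gb (hm : ends m = s(a, s)) (hsa : s ≠ a) (hca : c ≠ a) (hsc : s ≠ c) :
    2 * (univ.filter fun z : α → Bool =>
        (((¬ (openGraph (labelledOpen ends (fun y => z y && decide (y = m)))).Reachable s a ∧
        ¬ (openGraph (labelledOpen ends (fun y => z y && decide (y = m)))).Reachable s c) ∧
        (¬ (openGraph (labelledOpen ends (fun y => z y && decide (y = m)))).Reachable c a ∧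
        ¬ (openGraph (labelledOpen ends (fun y => z y && decide (y = m)))).Reachable c s)) ∧
        (¬ (openGraph (labelledOpen ends (fun l =>
          clusterFlip ends a (fun y => !(z y && decide (y = m))) l && decide (l = m)))).Reachable s a ∧
        ¬ (openGraph (labelledOpen ends (fun l =>
          clusterFlip ends a (fun y => !(z y && decide (y = m))) l && decide (l = m)))).Reachable s c))).card =
    0 + 0 := by
  have h := two_mul_card_series_Gb_mask ends s a c s m (fun _ => false) hm hsa hsa hca
    (fun l hl => absurd hl Bool.false_ne_true) rfl
  simp only [Bool.or_false] at h
  rw [h]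
  have hR := reachable_and_false ends
  congr 1
  · rw [Finset.filter_false_of_mem (fun z _ => by simp only [hR]; clear h; aesop), Finset.card_empty]
  · rw [Finset.filter_false_of_mem (fun z _ => by simp only [hR]; clear h; aesop), Finset.card_empty]


open Classical in
/-- Mark piece `s`-mark, statistic `G1`: `2·N = 0 + 0` (in units of configurations). [this work] -/
theorem two_mul_card_markS_G1 (hm : ends m = s(a, s)) (hsa : s ≠ a) (hca : c ≠ a) (hsc : s ≠ c) :
    2 * (univ.filter fun z : α → Bool =>
        (((¬ (openGraph (labelledOpen ends (fun y => z y && decide (y = m)))).Reachable s a ∧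
        ¬ (openGraph (labelledOpen ends (fun y => z y && decide (y = m)))).Reachable s c) ∧
        (¬ (openGraph (labelledOpen ends (fun y => z y && decide (y = m)))).Reachable c a ∧
        ¬ (openGraph (labelledOpen ends (fun y => z y && decide (y = m)))).Reachable c s)) ∧
        ((¬ (openGraph (labelledOpen ends (fun l =>
          clusterFlip ends a (fun y => !(z y && decide (y = m))) l && decide (l = m)))).Reachable s a ∧
        ¬ (openGraph (labelledOpen ends (fun l =>
          clusterFlip ends a (fun y => !(z y && decide (y = m))) l && decide (l = m)))).Reachable s c) ∧
        (¬ (openGraph (labelledOpen ends (fun l =>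
          clusterFlip ends a (fun y => !(z y && decide (y = m))) l && decide (l = m)))).Reachable c a ∧
        ¬ (openGraph (labelledOpen ends (fun l =>
          clusterFlip ends a (fun y => !(z y && decide (y = m))) l && decide (l = m)))).Reachable c s)))).card =
    0 + 0 := by
  have h := two_mul_card_series_G1_mask ends s a c s m (fun _ => false) hm hsa hsa hca
    (fun l hl => absurd hl Bool.false_ne_true) rfl
  simp only [Bool.or_false] at h
  rw [h]
  have hR := reachable_and_false ends
  congr 1
  · rw [Finset.filter_false_of_mem (fun z _ => by simp only [hR]; clear h; aesop), Finset.card_empty]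
  · rw [Finset.filter_false_of_mem (fun z _ => by simp only [hR]; clear h; aesop), Finset.card_empty]


open Classical in
/-- Mark piece `c`-mark, statistic `S0`: `2·N = U + 0` (in units of configurations). [this work] -/
theorem two_mul_card_markC_S0 (hm : ends m = s(a, c)) (hsa : s ≠ a) (hca : c ≠ a) (hsc : s ≠ c) :
    2 * (univ.filter fun z : α → Bool =>
        ((¬ (openGraph (labelledOpen ends (fun y => z y && decide (y = m)))).Reachable s a ∧
        ¬ (openGraph (labelledOpen ends (fun y => z y && decide (y = m)))).Reachable s c) ∧
        (¬ (openGraph (labelledOpen ends (fun y => z y && decide (y = m)))).Reachable c a ∧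
        ¬ (openGraph (labelledOpen ends (fun y => z y && decide (y = m)))).Reachable c s))).card =
    (univ : Finset (α → Bool)).card + 0 := by
  have h := two_mul_card_series_S0_mask ends s a c c m (fun _ => false) hm hca hsa hca
    (fun l hl => absurd hl Bool.false_ne_true) rfl
  simp only [Bool.or_false] at h
  rw [h]
  have hR := reachable_and_false ends
  congr 1
  · rw [Finset.filter_true_of_mem (fun z _ => by simp only [hR]; clear h; aesop)]
  · rw [Finset.filter_false_of_mem (fun z _ => by simp only [hR]; clear h; aesop), Finset.card_empty]


open Classical in
/-- Mark piece `c`-mark, statistic `isoC`: `2·N = U + 0` (in units of configurations). [this work] -/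
theorem two_mul_card_markC_isoC (hm : ends m = s(a, c)) (hsa : s ≠ a) (hca : c ≠ a) (hsc : s ≠ c) :
    2 * (univ.filter fun z : α → Bool =>
        (¬ (openGraph (labelledOpen ends (fun y => z y && decide (y = m)))).Reachable c a ∧
        ¬ (openGraph (labelledOpen ends (fun y => z y && decide (y = m)))).Reachable c s)).card =
    (univ : Finset (α → Bool)).card + 0 := by
  have h := two_mul_card_series_isoC_mask ends s a c c m (fun _ => false) hm hca hsa hca
    (fun l hl => absurd hl Bool.false_ne_true) rfl
  simp only [Bool.or_false] at h
  rw [h]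
  have hR := reachable_and_false ends
  congr 1
  · rw [Finset.filter_true_of_mem (fun z _ => by simp only [hR]; clear h; aesop)]
  · rw [Finset.filter_false_of_mem (fun z _ => by simp only [hR]; clear h; aesop), Finset.card_empty]


open Classical in
/-- Mark piece `c`-mark, statistic `isoS`: `2·N = U + U` (in units of configurations). [this work] -/
theorem two_mul_card_markC_isoS (hm : ends m = s(a, c)) (hsa : s ≠ a) (hca : c ≠ a) (hsc : s ≠ c) :
    2 * (univ.filter fun z : α → Bool =>
        (¬ (openGraph (labelledOpen ends (fun y => z y && decide (y = m)))).Reachable s a ∧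
        ¬ (openGraph (labelledOpen ends (fun y => z y && decide (y = m)))).Reachable s c)).card =
    (univ : Finset (α → Bool)).card + (univ : Finset (α → Bool)).card := by
  have h := two_mul_card_series_isoS_mask ends s a c c m (fun _ => false) hm hca hsa hca
    (fun l hl => absurd hl Bool.false_ne_true) rfl
  simp only [Bool.or_false] at h
  rw [h]
  have hR := reachable_and_false ends
  congr 1
  · rw [Finset.filter_true_of_mem (fun z _ => by simp only [hR]; clear h; aesop)]
  · rw [Finset.filter_true_of_mem (fun z _ => by simp only [hR]; clear h; aesop)]


open Classical in
/-- Mark piece `c`-mark, statistic `Ga`: `2·N = 0 + 0` (in units of configurations). [this work] -/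
theorem two_mul_card_markC_Ga (hm : ends m = s(a, c)) (hsa : s ≠ a) (hca : c ≠ a) (hsc : s ≠ c) :
    2 * (univ.filter fun z : α → Bool =>
        (((¬ (openGraph (labelledOpen ends (fun y => z y && decide (y = m)))).Reachable s a ∧
        ¬ (openGraph (labelledOpen ends (fun y => z y && decide (y = m)))).Reachable s c) ∧
        (¬ (openGraph (labelledOpen ends (fun y => z y && decide (y = m)))).Reachable c a ∧
        ¬ (openGraph (labelledOpen ends (fun y => z y && decide (y = m)))).Reachable c s)) ∧
        (¬ (openGraph (labelledOpen ends (fun l =>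
          clusterFlip ends a (fun y => !(z y && decide (y = m))) l && decide (l = m)))).Reachable c a ∧
        ¬ (openGraph (labelledOpen ends (fun l =>
          clusterFlip ends a (fun y => !(z y && decide (y = m))) l && decide (l = m)))).Reachable c s))).card =
    0 + 0 := by
  have h := two_mul_card_series_Ga_mask ends s a c c m (fun _ => false) hm hca hsa hca
    (fun l hl => absurd hl Bool.false_ne_true) rfl
  simp only [Bool.or_false] at h
  rw [h]
  have hR := reachable_and_false ends
  congr 1
  · rw [Finset.filter_false_of_mem (fun z _ => by simp only [hR]; clear h; aesop), Finset.card_empty]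
  · rw [Finset.filter_false_of_mem (fun z _ => by simp only [hR]; clear h; aesop), Finset.card_empty]


open Classical in
/-- Mark piece `c`-mark, statistic `Gb`: `2·N = U + 0` (in units of configurations). [this work] -/
theorem two_mul_card_markC_Gb (hm : ends m = s(a, c)) (hsa : s ≠ a) (hca : c ≠ a) (hsc : s ≠ c) :
    2 * (univ.filter fun z : α → Bool =>
        (((¬ (openGraph (labelledOpen ends (fun y => z y && decide (y = m)))).Reachable s a ∧
        ¬ (openGraph (labelledOpen ends (fun y => z y && decide (y = m)))).Reachable s c) ∧
        (¬ (openGraph (labelledOpen ends (fun y => z y && decide (y = m)))).Reachable c a ∧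
        ¬ (openGraph (labelledOpen ends (fun y => z y && decide (y = m)))).Reachable c s)) ∧
        (¬ (openGraph (labelledOpen ends (fun l =>
          clusterFlip ends a (fun y => !(z y && decide (y = m))) l && decide (l = m)))).Reachable s a ∧
        ¬ (openGraph (labelledOpen ends (fun l =>
          clusterFlip ends a (fun y => !(z y && decide (y = m))) l && decide (l = m)))).Reachable s c))).card =
    (univ : Finset (α → Bool)).card + 0 := by
  have h := two_mul_card_series_Gb_mask ends s a c c m (fun _ => false) hm hca hsa hca
    (fun l hl => absurd hl Bool.false_ne_true) rfl
  simp only [Bool.or_false] at h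
  rw [h]
  have hR := reachable_and_false ends
  congr 1
  · rw [Finset.filter_true_of_mem (fun z _ => by simp only [hR]; clear h; aesop)]
  · rw [Finset.filter_false_of_mem (fun z _ => by simp only [hR]; clear h; aesop), Finset.card_empty]


open Classical in
/-- Mark piece `c`-mark, statistic `G1`: `2·N = 0 + 0` (in units of configurations). [this work] -/
theorem two_mul_card_markC_G1 (hm : ends m = s(a, c)) (hsa : s ≠ a) (hca : c ≠ a) (hsc : s ≠ c) :
    2 * (univ.filter fun z : α → Bool =>
        (((¬ (openGraph (labelledOpen ends (fun y => z y && decide (y = m)))).Reachable s a ∧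
        ¬ (openGraph (labelledOpen ends (fun y => z y && decide (y = m)))).Reachable s c) ∧
        (¬ (openGraph (labelledOpen ends (fun y => z y && decide (y = m)))).Reachable c a ∧
        ¬ (openGraph (labelledOpen ends (fun y => z y && decide (y = m)))).Reachable c s)) ∧
        ((¬ (openGraph (labelledOpen ends (fun l =>
          clusterFlip ends a (fun y => !(z y && decide (y = m))) l && decide (l = m)))).Reachable s a ∧
        ¬ (openGraph (labelledOpen ends (fun l =>
          clusterFlip ends a (fun y => !(z y && decide (y = m))) l && decide (l = m)))).Reachable s c) ∧
        (¬ (openGraph (labelledOpen ends (fun l =>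
          clusterFlip ends a (fun y => !(z y && decide (y = m))) l && decide (l = m)))).Reachable c a ∧
        ¬ (openGraph (labelledOpen ends (fun l =>
          clusterFlip ends a (fun y => !(z y && decide (y = m))) l && decide (l = m)))).Reachable c s)))).card =
    0 + 0 := by
  have h := two_mul_card_series_G1_mask ends s a c c m (fun _ => false) hm hca hsa hca
    (fun l hl => absurd hl Bool.false_ne_true) rfl
  simp only [Bool.or_false] at h
  rw [h]
  have hR := reachable_and_false ends
  congr 1
  · rw [Finset.filter_false_of_mem (fun z _ => by simp only [hR]; clear h; aesop), Finset.card_empty]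
  · rw [Finset.filter_false_of_mem (fun z _ => by simp only [hR]; clear h; aesop), Finset.card_empty]


end Marks

end Summit.CriticalPhenomena.PercolationContinuityZ3.Theorems.ProductFormFibre
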